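import Mathlib
import HarnessLib

/-!
# `CompletionRelayChain` — crux `RelayFrontStep` (item stmt-NavierStokesRegularity-24850):
  the ONE-SIDED uniform bootstrap for a family (helper for LINE `window_v2`, stubs `stub_wake`,
  `stub_front`)

The tree's uniform bootstrap lemma `GappedFrontRobust.bootstrap_family`
(`Theorems/TaoLadderRungThreeGappedFrontRobustComparison.lean`) closes an upper-envelope bootstrap
over an arbitrary family `u_j` from (init), (improve: weak bound on `[0,t]` ⇒ strict bound at `t`)
and a UNIFORM TWO-SIDED Lipschitz bound `|u_j(t) − u_j(s)| ≤ L p_j |t − s|`. Along a restarted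
pseudo-flow the natural family is the energies `F_{i,k}`, for which only UPPER increments are
controlled — the energy inequality (4.9) `∂ₛF ≤ quadTerm(S)·S` is one-sided and there is no lower bound
on `∂ₛF`. This file proves the one-sided version the wake/front stubs of `window_v2` need: the same
conclusion from the ONE-SIDED growth bound `u_j(t) − u_j(s) ≤ L p_j (t − s)` for `s ≤ t`
(`bootstrap_family_oneSided`). The proof is the tree's (induction over steps of a length chosen from
`min ψ`, the uniform continuity of `ψ` and `L`), using the Lipschitz bound only upward from the
anchor of each step — which is all the original proof ever used.

No definitions. HONEST FRAMING: elementary real analysis ([folklore]); helper for the crux, no stub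
credit; nothing here is a statement about the Navier–Stokes equations.
-/

noncomputable section

-- the summit-side namespace `Summit.NavierStokesRegularity.NavierStokesRegularity.…` (single-conjunct summit,
-- D-0017) repeats a component by design; the dupNamespace linter would flag every declaration.
set_option linter.dupNamespace false

open Set

namespace Summit.NavierStokesRegularity.NavierStokesRegularity.Theorems

namespace RelayFrontStep

/-- **One-sided uniform bootstrap for a family.** Let `u_j : ℝ → ℝ` (`j` in any index type), scales
`p_j ≥ 0`, `ψ` continuous and positive on `[0, τ]`, `L ≥ 0`. Assume (init) `u_j(0) ≤ ψ(0) p_j`;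
(improve) for every `t ∈ [0, τ]`, if `u_j(s) ≤ 2 ψ(s) p_j` for all `j` and all `s ∈ [0, t]` then
`u_j(t) ≤ ψ(t) p_j` for all `j`; (uniform ONE-SIDED growth) `u_j(t) − u_j(s) ≤ L p_j (t − s)` for
`0 ≤ s ≤ t ≤ τ`. Then `u_j(t) ≤ ψ(t) p_j` for all `j` and all `t ∈ [0, τ]`. [folklore] -/
theorem bootstrap_family_oneSided {ι : Type*} {u : ι → ℝ → ℝ} {p : ι → ℝ} {ψ : ℝ → ℝ} {τ L : ℝ}
    (hp : ∀ j, 0 ≤ p j) (hL : 0 ≤ L) (hψ : ContinuousOn ψ (Icc 0 τ))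
    (hψpos : ∀ t ∈ Icc 0 τ, 0 < ψ t)
    (hgrow : ∀ j, ∀ s ∈ Icc 0 τ, ∀ t ∈ Icc 0 τ, s ≤ t → u j t - u j s ≤ L * p j * (t - s))
    (h0 : ∀ j, u j 0 ≤ ψ 0 * p j)
    (himp : ∀ t ∈ Icc 0 τ, (∀ j, ∀ s ∈ Icc 0 t, u j s ≤ 2 * ψ s * p j) → ∀ j, u j t ≤ ψ t * p j) :
    ∀ j, ∀ t ∈ Icc 0 τ, u j t ≤ ψ t * p j := by
  intro j₀ t₀ ht₀
  have hτ : 0 ≤ τ := ht₀.1.trans ht₀.2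
  -- the minimum of ψ on the compact interval
  obtain ⟨tm, htm, hmin⟩ := isCompact_Icc.exists_isMinOn (nonempty_Icc.mpr hτ) hψ
  set mψ : ℝ := ψ tm with hmψ
  have hmpos : 0 < mψ := hψpos tm htm
  have hmle : ∀ t ∈ Icc 0 τ, mψ ≤ ψ t := fun t ht => hmin ht
  -- uniform continuity of ψ: |t - s| < η₁ ⇒ |ψ t - ψ s| < mψ/2
  have huc := isCompact_Icc.uniformContinuousOn_of_continuous hψ
  rw [Metric.uniformContinuousOn_iff] at huc
  obtain ⟨η₁, hη₁pos, hη₁⟩ := huc (mψ / 2) (by positivity)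
  -- the step length
  set η : ℝ := min (η₁ / 2) (mψ / (2 * (L + 1))) with hη
  have hηpos : 0 < η := by
    have : 0 < mψ / (2 * (L + 1)) := by positivity
    exact lt_min (by positivity) this
  have hη₁' : η < η₁ := by
    have : η ≤ η₁ / 2 := min_le_left _ _
    linarith
  have hηL : L * η ≤ mψ / 2 := by
    have h1 : η ≤ mψ / (2 * (L + 1)) := min_le_right _ _
    have h2 : L * η ≤ L * (mψ / (2 * (L + 1))) := mul_le_mul_of_nonneg_left h1 hL
    have h3 : L * (mψ / (2 * (L + 1))) ≤ mψ / 2 := by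
      rw [mul_div_assoc']
      rw [div_le_div_iff₀ (by positivity) (by norm_num)]
      nlinarith
    linarith
  -- induction over the steps
  have key : ∀ n : ℕ, ∀ j, ∀ t ∈ Icc 0 τ, t ≤ n * η → u j t ≤ ψ t * p j := by
    intro n
    induction n with
    | zero =>
      intro j t ht htn
      have ht0 : t = 0 := le_antisymm (by simpa using htn) ht.1
      rw [ht0]
      exact h0 j
    | succ n ih =>
      intro j t ht htn
      by_cases hle : t ≤ n * η
      · exact ih j t ht hle
      push Not at hle
      -- the anchor s₀ = n η ∈ [0, τ]
      have hs₀ : (n : ℝ) * η ∈ Icc 0 τ := ⟨by positivity, (hle.le.trans ht.2)⟩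
      refine himp t ht (fun j' s hs => ?_) j
      have hsτ : s ∈ Icc 0 τ := ⟨hs.1, hs.2.trans ht.2⟩
      have hψs := hψpos s hsτ
      by_cases hsn : s ≤ n * η
      · have := ih j' s hsτ hsn
        nlinarith [hp j']
      · push Not at hsn
        -- one-sided growth from the anchor (s ≥ n η)
        have hdist : s - n * η ≤ η := by
          push_cast at htn
          linarith [hs.2]
        have h1 := hgrow j' _ hs₀ s hsτ hsn.le
        have h2 : u j' s ≤ u j' (n * η) + L * p j' * η := by
          have hb : L * p j' * (s - n * η) ≤ L * p j' * η :=
            mul_le_mul_of_nonneg_left hdist (mul_nonneg hL (hp j'))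
          linarith
        have h3 := ih j' _ hs₀ le_rfl
        -- ψ at the anchor vs ψ at s
        have h4 : ψ (n * η) ≤ ψ s + mψ / 2 := by
          have hd : dist s ((n : ℝ) * η) < η₁ := by
            rw [Real.dist_eq, abs_of_nonneg (by linarith)]
            exact lt_of_le_of_lt hdist hη₁'
          have := hη₁ s hsτ _ hs₀ hd
          rw [Real.dist_eq] at this
          linarith [(abs_lt.mp this).1, (abs_lt.mp this).2]
        have h5 : L * p j' * η ≤ mψ / 2 * p j' := by nlinarith [hp j']
        have h6 := hmle s hsτ
        nlinarith [hp j']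
  -- every t ∈ [0, τ] lies below some n η
  obtain ⟨n, hn⟩ := exists_nat_ge (t₀ / η)
  exact key n j₀ t₀ ht₀ (by rwa [div_le_iff₀ hηpos] at hn)

/-- **One-sided uniform bootstrap with an arbitrary slack factor `θ > 1`.** As
`bootstrap_family_oneSided`, but the weak bound fed to the improvement step is `u_j(s) ≤ θ ψ(s) p_j`
instead of `2 ψ(s) p_j`: (improve) for every `t ∈ [0, τ]`, if `u_j(s) ≤ θ ψ(s) p_j` for all `j`, all
`s ∈ [0, t]`, then `u_j(t) ≤ ψ(t) p_j`. (The wake energies of LINE `window_v2` need `θ` close to `1`: with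
`θ = 2` the cubic rates `Λ_k·A³` at old shell `−4` exceed the allowed growth, with `θ ≤ 1.2` they do
not — census §7.) The step length is chosen from `(θ−1)·min ψ`. [folklore] -/
theorem bootstrap_family_oneSided_slack {ι : Type*} {u : ι → ℝ → ℝ} {p : ι → ℝ} {ψ : ℝ → ℝ}
    {τ L θ : ℝ} (hθ : 1 < θ)
    (hp : ∀ j, 0 ≤ p j) (hL : 0 ≤ L) (hψ : ContinuousOn ψ (Icc 0 τ))
    (hψpos : ∀ t ∈ Icc 0 τ, 0 < ψ t)
    (hgrow : ∀ j, ∀ s ∈ Icc 0 τ, ∀ t ∈ Icc 0 τ, s ≤ t → u j t - u j s ≤ L * p j * (t - s))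
    (h0 : ∀ j, u j 0 ≤ ψ 0 * p j)
    (himp : ∀ t ∈ Icc 0 τ, (∀ j, ∀ s ∈ Icc 0 t, u j s ≤ θ * ψ s * p j) → ∀ j, u j t ≤ ψ t * p j) :
    ∀ j, ∀ t ∈ Icc 0 τ, u j t ≤ ψ t * p j := by
  intro j₀ t₀ ht₀
  have hτ : 0 ≤ τ := ht₀.1.trans ht₀.2
  set δ : ℝ := θ - 1 with hδ
  have hδpos : 0 < δ := by rw [hδ]; linarith
  -- the minimum of ψ on the compact interval
  obtain ⟨tm, htm, hmin⟩ := isCompact_Icc.exists_isMinOn (nonempty_Icc.mpr hτ) hψ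
  set mψ : ℝ := ψ tm with hmψ
  have hmpos : 0 < mψ := hψpos tm htm
  have hmle : ∀ t ∈ Icc 0 τ, mψ ≤ ψ t := fun t ht => hmin ht
  -- uniform continuity of ψ: |t - s| < η₁ ⇒ |ψ t - ψ s| < δ mψ/2
  have huc := isCompact_Icc.uniformContinuousOn_of_continuous hψ
  rw [Metric.uniformContinuousOn_iff] at huc
  obtain ⟨η₁, hη₁pos, hη₁⟩ := huc (δ * mψ / 2) (by positivity)
  -- the step length
  set η : ℝ := min (η₁ / 2) (δ * mψ / (2 * (L + 1))) with hη
  have hηpos : 0 < η := by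
    have : 0 < δ * mψ / (2 * (L + 1)) := by positivity
    exact lt_min (by positivity) this
  have hη₁' : η < η₁ := by
    have : η ≤ η₁ / 2 := min_le_left _ _
    linarith
  have hηL : L * η ≤ δ * mψ / 2 := by
    have h1 : η ≤ δ * mψ / (2 * (L + 1)) := min_le_right _ _
    have h2 : L * η ≤ L * (δ * mψ / (2 * (L + 1))) := mul_le_mul_of_nonneg_left h1 hL
    have h3 : L * (δ * mψ / (2 * (L + 1))) ≤ δ * mψ / 2 := by
      rw [mul_div_assoc']
      rw [div_le_div_iff₀ (by positivity) (by norm_num)]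
      have : 0 < δ * mψ := by positivity
      nlinarith
    linarith
  -- induction over the steps
  have key : ∀ n : ℕ, ∀ j, ∀ t ∈ Icc 0 τ, t ≤ n * η → u j t ≤ ψ t * p j := by
    intro n
    induction n with
    | zero =>
      intro j t ht htn
      have ht0 : t = 0 := le_antisymm (by simpa using htn) ht.1
      rw [ht0]
      exact h0 j
    | succ n ih =>
      intro j t ht htn
      by_cases hle : t ≤ n * η
      · exact ih j t ht hle
      push Not at hle
      have hs₀ : (n : ℝ) * η ∈ Icc 0 τ := ⟨by positivity, (hle.le.trans ht.2)⟩
      refine himp t ht (fun j' s hs => ?_) j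
      have hsτ : s ∈ Icc 0 τ := ⟨hs.1, hs.2.trans ht.2⟩
      have hψs := hψpos s hsτ
      by_cases hsn : s ≤ n * η
      · have := ih j' s hsτ hsn
        have : ψ s * p j' ≤ θ * ψ s * p j' := by nlinarith [hp j', mul_nonneg hψs.le (hp j')]
        linarith
      · push Not at hsn
        have hdist : s - n * η ≤ η := by
          push_cast at htn
          linarith [hs.2]
        have h1 := hgrow j' _ hs₀ s hsτ hsn.le
        have h2 : u j' s ≤ u j' (n * η) + L * p j' * η := by
          have hb : L * p j' * (s - n * η) ≤ L * p j' * η :=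
            mul_le_mul_of_nonneg_left hdist (mul_nonneg hL (hp j'))
          linarith
        have h3 := ih j' _ hs₀ le_rfl
        have h4 : ψ (n * η) ≤ ψ s + δ * mψ / 2 := by
          have hd : dist s ((n : ℝ) * η) < η₁ := by
            rw [Real.dist_eq, abs_of_nonneg (by linarith)]
            exact lt_of_le_of_lt hdist hη₁'
          have := hη₁ s hsτ _ hs₀ hd
          rw [Real.dist_eq] at this
          linarith [(abs_lt.mp this).1, (abs_lt.mp this).2]
        have h5 : L * p j' * η ≤ δ * mψ / 2 * p j' := by nlinarith [hp j']
        have h6 := hmle s hsτ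
        -- u ≤ ψ(anchor) p + δ mψ/2 p ≤ (ψ s + δ mψ) p ≤ (1 + δ) ψ s p = θ ψ s p
        have h7 : u j' s ≤ (ψ s + δ * mψ) * p j' := by nlinarith [hp j']
        have h8 : (ψ s + δ * mψ) * p j' ≤ θ * ψ s * p j' := by
          have : δ * mψ ≤ δ * ψ s := mul_le_mul_of_nonneg_left h6 hδpos.le
          have hθ' : θ = 1 + δ := by rw [hδ]; ring
          rw [hθ']
          nlinarith [hp j']
        linarith
  obtain ⟨n, hn⟩ := exists_nat_ge (t₀ / η)
  exact key n j₀ t₀ ht₀ (by rwa [div_le_iff₀ hηpos] at hn)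

end RelayFrontStep

end Summit.NavierStokesRegularity.NavierStokesRegularity.Theorems
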